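import Literature.MathematicalPhysics.QuantumFieldTheory.Balaban1983to89.B8Prop6CubeMemberScalarGammaOfIneq159Printed
import Literature.MathematicalPhysics.QuantumFieldTheory.Balaban1983to89.B8Ineq159FlatCubeMemberTransplant

/-!
# `Balaban1983to89.B8Prop6CubeMemberScalarGammaHolds` — [Balaban1985RegularSpaces] PROPOSITION 6 (p. 99), (1.135)–(1.138), AT EVERY CUBE OF PRINT'S
# BIG-BLOCK SUB-LATTICE — UNCONDITIONAL (`d ≥ 2`, odd `L ≥ 5`): the crown of the flat line γ with its one named flat fact DISCHARGED by dag-n05-c's transplant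

statement-level skeleton of published theorems with citation tags; proofs where landed; nothing here is a claim about the
Yang–Mills mass gap

PDF held: `paper:balaban1985-cmp99-regular-spaces-gauge-fixing`; Prop. 6 p. 99, p. 98 (the cubes of Prop. 6), Thm 4 p. 88, Prop. 3 p. 87, (1.58)–(1.62) pp. 86–87,
(1.31) p. 82.  [4] = `[Balaban1985BackgroundPropagators]` Thms 3.1–3.3 pp. 397–399; [B6] = `[Balaban1984PropagatorsII]` (2.3) p. 224, Prop. 2.6 (2.136) p. 247.

CITATION HEADER (lean-in-tree rule).  Cell `pub-ymgap` (HUMAN RULING D-0062, Track A), DAG node N05 = [B8], seat `pub-ymgap-dag-n05-e` g10 (R141 (C) row s3b —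
the FLAT line of Proposition 6's cube road, edition γ; file Fγ11).  WHY THIS FILE.  The crown `B8Prop6CubeMemberScalarGammaOfIneq159Printed.
gaugedBoundB8_cubeMember_scalar_γ_of_ineq159Printed` (p593169) gives Proposition 6 at every print-faithful cube from ONE named flat fact,
`B8Ineq159FlatCubeMemberPrinted.Ineq159FlatCubeMemberPrinted d L` ([B8] (1.59) at `U₀ = 1` over print's class on the Dirichlet cube = [4] Thm 3.3 ∕ [B6]
Prop. 2.6 at `U = 1`).  dag-n05-c's T4 `B8Ineq159FlatCubeMemberTransplant.ineq159FlatCubeMemberPrinted_holds (d ℓ) (hℓ : 4 ≤ ℓ) (hodd : Odd (ℓ + 1)) :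
Ineq159FlatCubeMemberPrinted (d + 1) (ℓ + 1)` PROVES that fact (transplant of lit-balaban's torus-with-level-0 Proposition 3, `B8Prop3MultiLevelTorusP26L0`, ME
#33) for every dimension and every odd `L ≥ 5`.  THIS FILE plugs it in: ★★★ `gaugedBoundB8_cubeMember_scalar_γ_holds` — `Node00.GaugedBoundB8 L η U₀ c
(7dL²·5dLB₀·Mα₀)` at every cube `c : CubeB8 d L K Ω` of print's big-block sub-lattice above threshold (`M_h = Lˢ ≥ 3`, the named fact's side conditions),
for every admissible `(U₀, α₀)` with «7dL²Mα₀ ≤ c₁», with NO hypothesis beyond `d ≥ 2`, `L ≥ 5` odd.  Kind «kernel-checked proof», one theorem, no `def`.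

HONEST SCOPE ∕ A6.  UNCONDITIONAL (standard axioms): every analytic input is a PROVED tree theorem — dag-n05-c's transplant T4 (on lit-balaban r05∕p38's
`B8Prop3MultiLevelTorus*L0` chain and the [B6] level-0 box∕torus estimates), dag-n05-c's REAL families and 𝒢-bound (F4e∕F7∕F8∕G3), this seat's γ re-assembly of
[B8] Thm 4 ∕ Prop. 5 ∕ Prop. 3 at the flat datum `(1, U₀″)` (Fγ1–Fγ10).  WHAT IT IS NOT: (i) not the family-level `B8.Prop6Printed ∘ zdCub` over ALL of NODE 00's
`CubeB8` cubes (LOCATED-CARRIER, this seat g9: `CubeB8` ⊋ print's p. 98 cubes; the print-faithful family is k0-s2-w2's `zdCubP` and k0-s2-w1's junction reads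
this theorem there); (ii) `L` odd `≥ 5` and `M_h = Lˢ` are the transplant's ∕ the named fact's parametrisation of print's «R₁, M₁ the smallest integers for which
[2, 4] hold», not a claim about other `L`; (iii) nothing about the N05 NODE's other members (Lemma 1, Thm 2, Props 3∕5∕7, Thms 4∕8 as separate slots) and
NOTHING continuum.  Count-neutral until the chair books; N05 NOT discharged by this file alone; one finite `𝕋⁴` programme at fixed `ε`, Bałaban as printed;
nothing continuum ∕ ℝ⁴ ∕ OS ∕ mass-gap ∕ Clay.  No `sorry`, no `def`, no `instance`, no `notation`.  Unit `pub-ymgap-dag-n05-e` (g10), 2026-08-28.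
-/

noncomputable section

open NormedSpace

namespace Literature.MathematicalPhysics.QuantumFieldTheory.Balaban1983to89.B8Prop6CubeMemberScalarGammaHolds

open B7Prop1Explicit B7Prop2Explicit B7Prop1Local
open B8Ineq132 (InAk)
open B8Ineq159FlatCubeMemberTransplant (ineq159FlatCubeMemberPrinted_holds)
open B8Prop6CubeMemberScalarGammaOfIneq159Printed (gaugedBoundB8_cubeMember_scalar_γ_of_ineq159Printed)
open Node00 (CubeB8 GaugedBoundB8)

export B7Prop1Explicit (Site)

variable {d : ℕ}

variable {𝔸 : Type} [CStarAlgebra 𝔸] [Nontrivial 𝔸]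

open Classical in
/-- ★★★ **PROPOSITION 6 (p. 99), (1.135)–(1.138), AT EVERY CUBE OF PRINT'S BIG-BLOCK SUB-LATTICE — UNCONDITIONAL** (`d ≥ 2`, `L ≥ 5` odd).  There are
`B₀ ≥ 1`, `c₁ > 0` and thresholds `ρ₀, M₀, N₀, R₀` (functions of `d, L`) such that for every `η > 0`, every cube `c : CubeB8 d L K Ω` whose datum lies on
print's p. 98 sub-lattice above threshold (`M_h = Lˢ ≥ 3`, `M₀ ≤ L^{s+1}`, `L^{s+1} ∣ ρ`, `L^{s+1} ∣ M`, `R·L^{s+1} ≤ ρ`, `2L ≤ R`, `R₀ ≤ R`, `N₀ + 1 ≤ R·L^{s+1}`,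
`ρ₀ ≤ ρ`) and every unitary `U₀ ∈ 𝔄_K({Ω_j}, α₀)` with `7dL²Mα₀ ≤ c₁`: `GaugedBoundB8 L η U₀ c (7dL²·5dLB₀·Mα₀)` — «there exists a gauge transformation u
defined on □̃ such that U₀^{u⁻¹} = U₁ = e^{iηA} on □̃ (1.135), Lʲη|A|, (Lʲη)²|∇^η A|, (Lʲη)³|∂^{η*}∂^η A|, (Lʲη)³|Δ^η A| ≤ 7dL²B₁Mα₀ on □_j (1.136), Q_k(ηA) =
(1∕i) log Ū₀′ᵏ on □^{(k)} (1.137)», in the Landau gauge (1.138) at background `1`.  PROOF: the crown `gaugedBoundB8_cubeMember_scalar_γ_of_ineq159Printed`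
(p593169) at dag-n05-c's PROVED named fact `ineq159FlatCubeMemberPrinted_holds (d − 1) (L − 1)` (T4 transplant); `5 ≤ d·L` from `d ≥ 2`, `L ≥ 5`.
[cite: Balaban1985RegularSpaces, Prop. 6 (1.135)–(1.138) p.99, p.98, Thm 4 p.88, Prop. 3 p.87, (1.59) p.86, (1.62) p.87, (1.31) p.82; Balaban1985BackgroundPropagators, Thm 3.3 p.399, Thm 3.2 (3.48) p.398, Thm 3.1 (3.47) p.398; Balaban1984PropagatorsII, Prop. 2.6 (2.136) p.247, (2.3) p.224] -/
theorem gaugedBoundB8_cubeMember_scalar_γ_holds (hd2 : 2 ≤ d) {L : ℕ} (hL5 : 5 ≤ L) (hodd : Odd L) :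
    ∃ B₀ c₁ ρ₀ M₀ : ℝ, ∃ N₀ R₀ : ℕ, 1 ≤ B₀ ∧ 0 < c₁ ∧ ∀ (η : ℝ), 0 < η → ∀ {K : ℕ} {Ω : ℕ → Set (Site d)} (c : CubeB8 d L K Ω),
      -- PRINT'S SIDE CONDITIONS (p. 98) on the cube datum (`M_h = Lˢ`), above threshold
      ∀ (s R : ℕ), 3 ≤ L ^ s → M₀ ≤ (L : ℝ) ^ (s + 1) → L ^ (s + 1) ∣ c.ρ → L ^ (s + 1) ∣ c.M → R * L ^ (s + 1) ≤ c.ρ → 2 * L ≤ R →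
        R₀ ≤ R → N₀ + 1 ≤ R * L ^ (s + 1) → ρ₀ ≤ (c.ρ : ℝ) →
      ∀ (U₀ : Site d → Fin d → 𝔸ˣ), (∀ x κ, U₀ x κ ∈ unitaryUnits 𝔸) → ∀ (α₀ : ℝ), 0 < α₀ → InAk L K η α₀ Ω U₀ →
      7 * d * (L : ℝ) ^ 2 * c.M * α₀ ≤ c₁ →
      GaugedBoundB8 L η U₀ c (7 * d * (L : ℝ) ^ 2 * (5 * (d : ℝ) * L * B₀) * c.M * α₀) := by
  obtain ⟨d', rfl⟩ : ∃ d', d = d' + 1 := ⟨d - 1, by omega⟩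
  obtain ⟨ℓ, rfl⟩ : ∃ ℓ, L = ℓ + 1 := ⟨L - 1, by omega⟩
  have hL : 2 ≤ ℓ + 1 := by omega
  have hdL : 5 ≤ (d' + 1) * (ℓ + 1) := le_trans hL5 (Nat.le_mul_of_pos_left _ (Nat.succ_pos d'))
  exact gaugedBoundB8_cubeMember_scalar_γ_of_ineq159Printed (𝔸 := 𝔸) hd2 hL hdL (ineq159FlatCubeMemberPrinted_holds d' ℓ (by omega) hodd)

#print axioms gaugedBoundB8_cubeMember_scalar_γ_holds

end Literature.MathematicalPhysics.QuantumFieldTheory.Balaban1983to89.B8Prop6CubeMemberScalarGammaHolds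

end
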